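import Literature.AlgebraicGeometry.GroupSchemes.BarsottiTateGroupBaseChange
import Literature.AlgebraicGeometry.AbelianSchemes.PDivisibleGroupOfAbelianScheme
import Literature.AlgebraicGeometry.AbelianSchemes.AbelianSchemeOverZariskiGluingDatum
import Literature.AlgebraicGeometry.Morphisms.FlatModuloNilpotent
import HarnessLib

/-!
# Serre–Tate, the σ2 «δ-road»: a FLAT SURJECTIVE cover `Y[p²] ↠ Ker (β₂)` of the kernel of the lifted multiple
# `β₂ : B[p²] → Y`, from the torsion of the smooth (abelian) side ([Katz1981SerreTate] §1.2, proof of Thm. 1.2.1)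

Layer `Literature/AlgebraicGeometry/GroupSchemes`, namespace `Literature.AlgebraicGeometry.GroupSchemes.SerreTateKernel`.
THEOREMS ONLY (no definition, no named fact, no instance, no notation, no `sorry`).

THE PRINT.  [Katz1981SerreTate] §1.2, proof of Thm. 1.2.1 (pp. 144–146): `R` Artinian local, `I ⊆ R` with `𝔪 · I = 0` (so
`I² = 0`, `p · I = 0`); `X₀` abelian over `R₀ = R⧸I` with `p`-divisible group `B₀ = X₀[p^∞]`, a deformation `B` of `B₀` to `R`, an
abelian deformation `Y` of `X₀`, and Drinfeld's lift «`p · (B₀[pⁿ] ↪ X₀)`» `β n : B[pⁿ] → Y` (Lemma 1.1.3 (3)); the kernel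
`K = Ker (β₂) ⊂ B[p²]` is shown flat by comparing it with the torsion of the smooth side.  THIS FILE is the KERNEL HALF of that
step, with the lifting problem factored OUT as a DATUM: GIVEN `δ₂ : Y[p²] → B[p²]` over `R` killed by `β₂` and REDUCING MODULO `I`
TO `p · ε₂⁻¹` (`ε₂ : B₀[p²] ≅ X₀[p²]`; in the base-change-square currency: on the reduction `X₀[p²] ↪ Y[p²]`, `δ₂` is `e^p` pushed
along `c 2 : B₀[p²] → B[p²]`, `e : X₀[p²] → B₀[p²]` the kernel comparison), there is `δ : Y[p²] → K` with `iK ∘ δ = δ₂`, FLAT and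
SURJECTIVE (so `K` is flat over `R` — the consumer's junction).  The datum is produced elsewhere: from ONE lifting when `B` is
formally smooth (★ `SerreTateKernelFlatCoverOfFormallySmooth`), or by gluing `p`-th powers of local liftings.
ROAD.  `δ` exists by the kernel clause.  MODULO `I`, `K` is `X₀[p]`: a point of `B[p²]` over `R₀` is a point of `B₀[p²] ≅ X₀[p²]`
(cartesian `c 2`), and it is killed by `β₂ = lift of p · i₀` iff its `p`-th multiple vanishes in `X₀` (push-forward along the
cartesian `GY : X₀ → Y` is injective) — the square `(X₀[p] → K, X₀[p] → Spec R₀, K → Spec R, Spec R₀ ↪ Spec R)` is CARTESIAN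
(§1: monomorphic edge + lifts); and `δ` restricts to `[p] : X₀[p²] ↠ X₀[p]`, FLAT and SURJECTIVE (★
`AbelianSchemeOver.flat∕surjective_torsionMulMap_left`), the square `(X₀[p²] → Y[p²], [p], δ, X₀[p] → K)` being cartesian because
TORSION COMMUTES WITH BASE CHANGE (§2).  Since `Y[p²]` is flat over `R` and `I` is nilpotent, `δ` is flat by [Matsumura1987]
Thm. 22.3 (★ `Morphisms.flat_of_flat_of_isPullback_specMap_quotient_mk`), and surjective because `Spec R₀ → Spec R` is onto.

* §1 `isPullback_of_mono_of_exists_lift` — a commuting square with monomorphic top edge is cartesian as soon as lifts exist.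
* §2 base-change squares `G : X₀ → Y` of abelian schemes (★ `AbelianSchemeOver.IsBaseChangeVia`, `g` mono): the UNIT square is
  cartesian; `G` commutes with `[N]`; `pushHom` is injective; **torsion commutes with base change** (`exists_torsion_isPullback`);
  and the kernel comparison `X[N] → G` for any kernel embedding `G ↪ X` of `[N]` (`exists_torsion_comparison`).
* §3 **`exists_flat_surjective_torsion_to_kernel`** — the statement above, in the binders of the σ2 sub-line of the cell's Serre–Tate
  line (crux `HLiu418`; the predicate «`i₀` exhibits `B₀` as `X₀[p^∞]`» spelled out as its three clauses; then the reduction map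
  `j : X₀[p²] → Y[p²]`, the comparison `e : X₀[p²] → B₀[p²]`, and the δ₂-DATUM).

Cell hodgecm-mathlib (D-0151 ∕ D-0183 FLOOR 0), P6 «MOD programme» Row 4B, sub-desk P6b, deal A6 = KF2-core (W1′-i) of
`Cruxes/HLiu418/Lines/F0_P6b_Sigma2KernelFlat` (desk F0P6b-plan (g13); prover F0P2-p01 (g30)); generic, count-neutral capital on
`--supports stmt-HodgeConjecture-24832`.  HC_CM is proved only modulo the printed citations until rung 0 closes; nothing here is about HC.

## References
* [Katz1981SerreTate] N. Katz, *Serre–Tate local moduli*, in: Surfaces algébriques (Orsay 1976–78), LNM 868 (1981), Exp. V-bis,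
  §1.1 Lemmas 1.1.2–1.1.3 (pp. 141–143), §1.2 Thm. 1.2.1 and its proof (pp. 144–146).
* [Messing1972] W. Messing, *The Crystals Associated to Barsotti–Tate Groups*, LNM 264 (1972), Ch. II Thm. (3.3.13).
* [Matsumura1987] H. Matsumura, *Commutative Ring Theory*, CSAM 8 (1987), §22 Thm. 22.3 (flatness modulo a nilpotent ideal).
* [Tate1967] J. Tate, *p-divisible groups*, Proc. Conf. Local Fields (Driebergen 1966), Springer (1967), §2 (2.1).
* [MumfordFogartyKirwan1994] D. Mumford, J. Fogarty, F. Kirwan, *Geometric Invariant Theory*, 3rd ed. (1994), Ch. 6 §1 (p. 115), Ch. 7 §2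
  Def. 7.2 (p. 129) (base change of abelian schemes).
* [GortzWedhorn2020] U. Görtz, T. Wedhorn, *Algebraic Geometry I*, 2nd ed. (2020), Section (4.15) and Def. 4.42 (points of a base change).
-/

noncomputable section

-- Mathlib's `Over`/pull-back API is stated across semireducible wrappers (as in the ★ `GroupSchemes/*` files).
set_option backward.isDefEq.respectTransparency false

universe v' u' u

open CategoryTheory CategoryTheory.Limits AlgebraicGeometry MonoidalCategory CartesianMonoidalCategory IsLocalRing
open scoped MonObj

namespace Literature.AlgebraicGeometry.GroupSchemes

namespace SerreTateKernel

open Literature.AlgebraicGeometry.AbelianSchemes Literature.AlgebraicGeometry.Motives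

/-! ## §1 A square with monomorphic top edge is cartesian as soon as lifts exist -/

/-- **A commuting square `f ≫ h = g ≫ k` whose edge `f` is a MONOMORPHISM is cartesian as soon as every pair
`(a : T → X, b : T → Y)` with `a ≫ h = b ≫ k` lifts through `(f, g)`** (the lift is unique because `f` is mono).
[cite: Tate1967, §2 (2.1)] -/
theorem isPullback_of_mono_of_exists_lift {C : Type u'} [Category.{v'} C] {P X Y Z : C} (f : P ⟶ X) [Mono f]
    (g : P ⟶ Y) (h : X ⟶ Z) (k : Y ⟶ Z) (w : f ≫ h = g ≫ k)
    (hlift : ∀ ⦃T : C⦄ (a : T ⟶ X) (b : T ⟶ Y), a ≫ h = b ≫ k → ∃ l : T ⟶ P, l ≫ f = a ∧ l ≫ g = b) :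
    IsPullback f g h k := by
  refine IsPullback.of_isLimit' ⟨w⟩ (PullbackCone.IsLimit.mk _
    (fun c => (hlift c.fst c.snd c.condition).choose)
    (fun c => (hlift c.fst c.snd c.condition).choose_spec.1)
    (fun c => (hlift c.fst c.snd c.condition).choose_spec.2) (fun c m hm _ => ?_))
  rw [← cancel_mono f, hm, (hlift c.fst c.snd c.condition).choose_spec.1]

/-! ## §2 Base-change squares of abelian schemes: the unit square, `[N]`, injectivity on points, torsion -/

section BaseChange

variable {S S' : Scheme.{u}} {A' : AbelianSchemeOver S'} {A : AbelianSchemeOver S} {g : S' ⟶ S}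
  {G : A'.X.left ⟶ A.X.left} (hG : A'.IsBaseChangeVia A g G)

include hG in
/-- **The UNIT SQUARE of a base-change square `G : X₀ → Y` of abelian schemes (★ `IsBaseChangeVia`, over a monomorphism
`g : S₀ → S`) is cartesian**: `S₀ = S ×_Y X₀` — a point `x` of `X₀` with `G x` the unit IS the unit (test against the cartesian
`(G, g)`). [cite: MumfordFogartyKirwan1994, Ch. 7 §2 Definition 7.2 (p. 129)] -/
theorem isPullback_unit_of_isBaseChangeVia [Mono g] : IsPullback g η[A'.X].left η[A.X].left G := by
  refine isPullback_of_mono_of_exists_lift g _ _ G hG.snd.2.1.symm ?_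
  intro T a b hab
  have hηA : η[A.X].left ≫ A.X.hom = 𝟙 S := by rw [Over.w]; rfl
  have hηA' : η[A'.X].left ≫ A'.X.hom = 𝟙 S' := by rw [Over.w]; rfl
  have ha : (b ≫ A'.X.hom) ≫ g = a := by
    rw [Category.assoc, ← hG.fst, ← Category.assoc, ← hab, Category.assoc, hηA, Category.comp_id]
  refine ⟨b ≫ A'.X.hom, ha, ?_⟩
  apply hG.snd.1.hom_ext
  · rw [Category.assoc, hG.snd.2.1, ← Category.assoc, ha, hab]
  · rw [Category.assoc, hηA', Category.comp_id]

include hG in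
/-- `G` commutes with multiplication by `N`: `G ≫ [N]_Y = [N]_{X₀} ≫ G` (push the point `𝟙_{X₀}` forward: ★ `pushHom` is
multiplicative). [cite: MumfordFogartyKirwan1994, Ch. 6 §1 (p. 115) and Ch. 7 §2 Definition 7.2 (p. 129)] -/
theorem comp_mulN_left_of_isBaseChangeVia (N : ℕ) : G ≫ (A.mulN N).left = (A'.mulN N).left ≫ G := by
  have h1 : hG.pushHom ((𝟙 A'.X) ^ N) = (hG.pushHom (𝟙 A'.X)) ^ N :=
    map_pow (MonoidHom.mk' hG.pushHom hG.pushHom_mul) (𝟙 A'.X) N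
  have h2 : (hG.pushHom (𝟙 A'.X)) ^ N = hG.pushHom (𝟙 A'.X) ≫ A.mulN N := by rw [AbelianSchemeOver.comp_mulN]
  have h3 := congrArg Over.Hom.left (h1.trans h2)
  rw [Over.comp_left, AbelianSchemeOver.IsBaseChangeVia.pushHom_left,
    AbelianSchemeOver.IsBaseChangeVia.pushHom_left, Over.id_left, Category.id_comp, ← AbelianSchemeOver.mulN_def] at h3
  exact h3.symm

include hG in
/-- **`pushHom` is INJECTIVE**: two `T`-points of `X₀` with the same push-forward to `Y` are equal (test against the
cartesian `(G, g)`). [cite: GortzWedhorn2020, Section (4.15) (p. 116)] -/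
theorem pushHom_injective {T : Over S'} (f f' : T ⟶ A'.X) (h : hG.pushHom f = hG.pushHom f') : f = f' := by
  have h1 : f.left ≫ G = f'.left ≫ G := by
    rw [← AbelianSchemeOver.IsBaseChangeVia.pushHom_left hG, ← AbelianSchemeOver.IsBaseChangeVia.pushHom_left hG, h]
  apply Over.OverMorphism.ext
  exact hG.snd.1.hom_ext h1 (by rw [Over.w, Over.w])

include hG in
/-- **TORSION COMMUTES WITH BASE CHANGE.**  For `G : X₀ → Y` a base-change square of abelian schemes over a monomorphism
`g : S₀ → S` and every `N`, there is `j : X₀[N] → Y[N]` over `g` with `j ≫ ι_{Y[N]} = ι_{X₀[N]} ≫ G`, and the square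
`(j, X₀[N] → S₀, Y[N] → S, g)` is CARTESIAN — `X₀[N] = Y[N] ×_S S₀` (both torsions are pull-backs of unit sections along `[N]`;
`G` commutes with `[N]` and is cartesian on units). [cite: Tate1967, §2 (2.1)] [cite: MumfordFogartyKirwan1994, Ch. 7 §2 Definition 7.2 (p. 129)] -/
theorem exists_torsion_isPullback [Mono g] (N : ℕ) :
    ∃ j : Over.mk ((A'.torsion N).hom ≫ g) ⟶ A.torsion N,
      j.left ≫ (A.torsionι N).left = (A'.torsionι N).left ≫ G ∧
      IsPullback j.left (A'.torsion N).hom (A.torsion N).hom g := by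
  have hkill : hG.pushHom (A'.torsionι N) ≫ A.mulN N = 1 := by
    have h1 : (hG.pushHom (A'.torsionι N)) ^ N = hG.pushHom ((A'.torsionι N) ^ N) :=
      (map_pow (MonoidHom.mk' hG.pushHom hG.pushHom_mul) _ N).symm
    rw [AbelianSchemeOver.comp_mulN, h1, ← AbelianSchemeOver.comp_mulN, AbelianSchemeOver.torsionι_comp_mulN,
      AbelianSchemeOver.IsBaseChangeVia.pushHom_one]
  refine ⟨A.torsionLift _ hkill, ?_, ?_⟩
  · have h := congrArg Over.Hom.left (A.torsionLift_ι _ hkill)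
    rw [Over.comp_left, AbelianSchemeOver.IsBaseChangeVia.pushHom_left] at h
    exact h
  · have hj : (A.torsionLift _ hkill).left ≫ (A.torsionι N).left = (A'.torsionι N).left ≫ G := by
      have h := congrArg Over.Hom.left (A.torsionLift_ι _ hkill)
      rw [Over.comp_left, AbelianSchemeOver.IsBaseChangeVia.pushHom_left] at h
      exact h
    have big : IsPullback ((A'.torsion N).hom ≫ g) (A'.torsionι N).left η[A.X].left ((A'.mulN N).left ≫ G) :=
      (A'.isPullback_torsionι_left N).flip.paste_horiz (isPullback_unit_of_isBaseChangeVia hG)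
    have e1 : (A'.torsion N).hom ≫ g = (A.torsionLift _ hkill).left ≫ (A.torsion N).hom := (Over.w (A.torsionLift _ hkill)).symm
    rw [e1, ← comp_mulN_left_of_isBaseChangeVia hG] at big
    have sqA : IsPullback (A.torsionLift _ hkill).left (A'.torsionι N).left (A.torsionι N).left G :=
      IsPullback.of_right big hj (A.isPullback_torsionι_left N).flip
    have h := sqA.paste_vert hG.snd.1
    rw [Over.w, Over.w] at h
    exact h

/-- **The kernel comparison**: for a kernel embedding `i : G ↪ X` of `[N]` (the square `(i, !, [N], e)` cartesian — a clause of ★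
`BTGroup.IsOfAbelianScheme`), the torsion `X[N]` maps to `G` over `X`: `∃ e : X[N] → G, e ≫ i = ι_{X[N]}`. [cite: Tate1967, §2 (2.1)] -/
theorem exists_torsion_comparison (X : AbelianSchemeOver S) {T : Over S} (N : ℕ) (i : T ⟶ X.X)
    (hi : IsPullback i (toUnit T) ((𝟙 X.X) ^ N) η[X.X]) : ∃ e : X.torsion N ⟶ T, e ≫ i = X.torsionι N :=
  have hk : X.torsionι N ≫ (𝟙 X.X) ^ N = toUnit _ ≫ η[X.X] := by
    rw [← AbelianSchemeOver.mulN_def, AbelianSchemeOver.torsionι_comp_mulN, Hom.one_def]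
  ⟨hi.lift _ _ hk, hi.lift_fst _ _ hk⟩

end BaseChange

/-! ## §3 The flat surjective cover `Y[p²] ↠ Ker (β₂)` from a δ₂-datum -/

/-- **KERNEL HALF OF THE δ-ROAD: A FLAT SURJECTIVE COVER OF `Ker (β₂)` FROM A δ₂-DATUM** ([Katz1981SerreTate] §1.2, proof of
Thm. 1.2.1, Messing-free).  SETTING (the σ2 data, binders verbatim): `p` prime, nilpotent in the Artinian local `A`; `J ≠ ⊤` with
`𝔪_A · J = 0`; `X₀` abelian of relative dimension `g` over `A⧸J` with `i₀` exhibiting the Barsotti–Tate group `B₀` as `X₀[p^∞]`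
(homomorphic kernel embeddings of `[pⁿ]`, compatible with the transitions); `B ∕ A` a Barsotti–Tate group reducing to `B₀` (`c`);
`Y ∕ A` abelian reducing to `X₀` (`GY`); `β n : B[pⁿ] → Y` homomorphisms compatible with the transitions and LIFTING `p · i₀ n`
(`c n ≫ β n = (i₀ n)^p ≫ GY`); `iK : K ↪ B[p²]` a closed finite subscheme through which exactly the `T`-points killed by `β 2` factor.
DATUM: the reduction map `j : X₀[p²] → Y[p²]` (over `GY`), the kernel comparison `e : X₀[p²] → B₀[p²]` (`e ≫ i₀ 2 = ι`), and
`δ₂ : Y[p²] → B[p²]` over `A` with `δ₂ ≫ β 2 = 1` and `j ≫ δ₂ = e^p ≫ c 2` («`δ₂` lifts `p · ε₂⁻¹`»).  CONCLUSION: `∃ δ : Y[p²] → K`,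
FLAT and SURJECTIVE.  Proof: `δ` from the kernel clause; modulo `J`, `K` is `X₀[p]` (cartesian square, §1) and `δ` is
`[p] : X₀[p²] ↠ X₀[p]` (§2), flat and surjective; flatness modulo the nilpotent `J` ([Matsumura1987] Thm. 22.3) and a one-point base.
[cite: Katz1981SerreTate, §1.2 proof of Theorem 1.2.1 (pp. 144–146) and §1.1 Lemmas 1.1.2–1.1.3 (pp. 141–143)]
[cite: Matsumura1987, §22 Theorem 22.3] [cite: Tate1967, §2 (2.1)] -/
theorem exists_flat_surjective_torsion_to_kernel :
    ∀ (p : ℕ), p.Prime → ∀ (A : Type u) [CommRing A] [IsArtinianRing A] [IsLocalRing A], IsNilpotent (p : A) →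
      ∀ (J : Ideal A), J ≠ ⊤ → maximalIdeal A * J = ⊥ →
      ∀ (g : ℕ) (X₀ : AbelianSchemeOver (Spec (.of (A ⧸ J)))), X₀.IsOfRelDim g →
      ∀ (B₀ : BTGroup (Spec (.of (A ⧸ J))) p (2 * g)) (i₀ : ∀ n, B₀.G n ⟶ X₀.X),
        ((∀ n, letI := B₀.grpObj n; IsMonHom (i₀ n)) ∧
          (∀ n, IsPullback (i₀ n) (toUnit (B₀.G n)) (((𝟙 X₀.X : X₀.X ⟶ X₀.X) ^ (p ^ n) : X₀.X ⟶ X₀.X)) η[X₀.X]) ∧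
          (∀ n, B₀.incl n ≫ i₀ (n + 1) = i₀ n)) →
      ∀ (B : BTGroup (Spec (.of A)) p (2 * g)) (c : ∀ n, (B₀.G n).left ⟶ (B.G n).left),
        B₀.IsBaseChangeVia B (Spec.map (CommRingCat.ofHom (Ideal.Quotient.mk J))) c →
      ∀ (Y : AbelianSchemeOver (Spec (.of A))), Y.IsOfRelDim g → ∀ (GY : X₀.X.left ⟶ Y.X.left),
        X₀.IsBaseChangeVia Y (Spec.map (CommRingCat.ofHom (Ideal.Quotient.mk J))) GY →
      ∀ (β : ∀ n, B.G n ⟶ Y.X), (∀ n, letI := B.grpObj n; IsMonHom (β n)) → (∀ n, B.incl n ≫ β (n + 1) = β n) →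
        (∀ n, c n ≫ (β n).left = ((i₀ n) ^ p).left ≫ GY) →
      ∀ (K : Over (Spec (.of A))) (iK : K ⟶ B.G 2), IsClosedImmersion iK.left → IsFinite K.hom →
        (∀ (T : Over (Spec (.of A))) (u : T ⟶ B.G 2), u ≫ β 2 = 1 ↔ ∃ v : T ⟶ K, v ≫ iK = u) →
      ∀ (j : Over.mk ((X₀.torsion (p ^ 2)).hom ≫ Spec.map (CommRingCat.ofHom (Ideal.Quotient.mk J))) ⟶ Y.torsion (p ^ 2)),
        j.left ≫ (Y.torsionι (p ^ 2)).left = (X₀.torsionι (p ^ 2)).left ≫ GY →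
      ∀ (e : X₀.torsion (p ^ 2) ⟶ B₀.G 2), e ≫ i₀ 2 = X₀.torsionι (p ^ 2) →
      ∀ (δ₂ : Y.torsion (p ^ 2) ⟶ B.G 2), δ₂ ≫ β 2 = 1 →
        j.left ≫ δ₂.left = (letI := B₀.grpObj 2; (e ^ p).left) ≫ c 2 →
        ∃ δ : Y.torsion (p ^ 2) ⟶ K, Flat δ.left ∧ Surjective δ.left := by
  intro p hp A _ _ _ _ J hJ hmJ g X₀ _ B₀ i₀ hT B c hBc Y _ GY hGY β hβ₁ _ hβ₃ K iK hKc _ hKer j hj e he δ₂ hβδ hred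
  obtain ⟨hi₀m, hi₀P, -⟩ := hT
  letI : ∀ k, GrpObj (B.G k) := B.grpObj
  letI : ∀ k, GrpObj (B₀.G k) := B₀.grpObj
  haveI := hi₀m 2
  haveI := hβ₁
  have hJJ : J * J = ⊥ := le_bot_iff.mp (hmJ ▸ Ideal.mul_mono_left (IsLocalRing.le_maximalIdeal hJ))
  have hp0 : p ≠ 0 := hp.ne_zero; have hp2 : p ^ 2 ≠ 0 := pow_ne_zero 2 hp0
  haveI hιc : IsClosedImmersion (Spec.map (CommRingCat.ofHom (Ideal.Quotient.mk J))) :=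
    @IsClosedImmersion.spec_of_quotient_mk (.of A) J
  haveI : Flat (Y.torsion (p ^ 2)).hom := Y.flat_torsion_hom hp2
  obtain ⟨wB2, hcB2, -, -⟩ := hBc.1 2
  -- §A the given reduction map `j` IS the base change of §2 (`ι_{Y[p²]}` is a monomorphism), hence cartesian
  obtain ⟨jP, hjP, hcP0⟩ := exists_torsion_isPullback hGY (p ^ 2)
  have hjj : j.left = jP.left := by
    haveI := Y.isClosedImmersion_torsionι_left (p ^ 2)
    rw [← cancel_mono (Y.torsionι (p ^ 2)).left, hj, hjP]
  have hcP : IsPullback j.left (X₀.torsion (p ^ 2)).hom (Y.torsion (p ^ 2)).hom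
      (Spec.map (CommRingCat.ofHom (Ideal.Quotient.mk J))) := by
    rw [hjj]; exact hcP0
  -- §I `δ₂` FACTORS THROUGH THE KERNEL: `δ : Y[p²] ⟶ K`, `δ ≫ iK = δ₂`
  obtain ⟨δ, hδ⟩ := (hKer _ δ₂).mp hβδ
  -- §J THE KERNEL MODULO `J` IS `X₀[p]`: `u = (X₀[p] ↪ X₀[p²] ≅ B₀[p²] ↪ B[p²])` is killed by `β 2`, so `u = iK ∘ iQ`, and
  -- the square `(iQ, X₀[p] → Spec (A⧸J), K → Spec A, Spec (A⧸J) ↪ Spec A)` is CARTESIAN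
  have hsq' : p ^ 2 = p * p := pow_two p
  have hdvd : p ∣ p ^ 2 := dvd_pow_self p two_ne_zero
  let u : Over.mk ((X₀.torsion p).hom ≫ Spec.map (CommRingCat.ofHom (Ideal.Quotient.mk J))) ⟶ B.G 2 :=
    Over.homMk ((X₀.torsionIncl p (p ^ 2) hdvd ≫ e).left ≫ c 2) (by
      change ((X₀.torsionIncl p (p ^ 2) hdvd ≫ e).left ≫ c 2) ≫ (B.G 2).hom = (X₀.torsion p).hom ≫ _
      rw [Category.assoc, wB2, ← Category.assoc, Over.w])
  have huβ : u ≫ β 2 = 1 := by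
    apply Over.OverMorphism.ext
    change ((X₀.torsionIncl p (p ^ 2) hdvd ≫ e).left ≫ c 2) ≫ (β 2).left = _
    rw [Category.assoc, hβ₃ 2, ← Category.assoc, ← Over.comp_left, MonObj.comp_pow, Category.assoc, he,
      AbelianSchemeOver.torsionIncl_ι, ← AbelianSchemeOver.comp_mulN, AbelianSchemeOver.torsionι_comp_mulN,
      ← AbelianSchemeOver.IsBaseChangeVia.pushHom_left hGY, AbelianSchemeOver.IsBaseChangeVia.pushHom_one]
  obtain ⟨iQ, hiQ⟩ := (hKer _ u).mp huβ
  haveI : IsClosedImmersion (c 2) := MorphismProperty.of_isPullback (P := @IsClosedImmersion) hcB2.flip hιc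
  haveI : Mono iQ.left := by
    haveI : Mono ((X₀.torsionIncl p (p ^ 2) hdvd ≫ e).left ≫ (i₀ 2).left) := by
      rw [← Over.comp_left, Category.assoc, he, AbelianSchemeOver.torsionIncl_ι]
      haveI := X₀.isClosedImmersion_torsionι_left p
      infer_instance
    haveI : Mono (X₀.torsionIncl p (p ^ 2) hdvd ≫ e).left := mono_of_mono _ (i₀ 2).left
    haveI : Mono (iQ ≫ iK).left := by
      rw [hiQ]
      change Mono ((X₀.torsionIncl p (p ^ 2) hdvd ≫ e).left ≫ c 2)
      infer_instance
    haveI : Mono (iQ.left ≫ iK.left) := by rw [← Over.comp_left]; infer_instance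
    exact mono_of_mono iQ.left iK.left
  have hQ : IsPullback iQ.left (X₀.torsion p).hom K.hom (Spec.map (CommRingCat.ofHom (Ideal.Quotient.mk J))) := by
    refine isPullback_of_mono_of_exists_lift _ _ _ _ (Over.w iQ) ?_
    intro T a b hab
    let aO : Over.mk (b ≫ Spec.map (CommRingCat.ofHom (Ideal.Quotient.mk J))) ⟶ K := Over.homMk a hab
    have haβ : (aO ≫ iK) ≫ β 2 = 1 := (hKer _ _).mpr ⟨aO, rfl⟩
    let yO : Over.mk b ⟶ B₀.G 2 := Over.homMk (hcB2.lift (aO ≫ iK).left b (Over.w (aO ≫ iK))) (hcB2.lift_snd _ _ _)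
    have hyO : yO.left ≫ c 2 = (aO ≫ iK).left := hcB2.lift_fst _ _ _
    have hxp : (yO ≫ i₀ 2) ^ p = 1 := by
      apply pushHom_injective hGY
      rw [AbelianSchemeOver.IsBaseChangeVia.pushHom_one]
      apply Over.OverMorphism.ext
      rw [AbelianSchemeOver.IsBaseChangeVia.pushHom_left, ← MonObj.comp_pow, Over.comp_left, Category.assoc, ← hβ₃ 2,
        ← Category.assoc, hyO, ← Over.comp_left, haβ]
    have hxN : (yO ≫ i₀ 2) ≫ X₀.mulN p = 1 := by rw [AbelianSchemeOver.comp_mulN, hxp]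
    have hz : X₀.torsionLift _ hxN ≫ X₀.torsionIncl p (p ^ 2) hdvd ≫ e = yO := by
      apply (hi₀P 2).hom_ext
      · rw [Category.assoc, Category.assoc, he, AbelianSchemeOver.torsionIncl_ι, AbelianSchemeOver.torsionLift_ι]
      · exact toUnit_unique _ _
    refine ⟨(X₀.torsionLift _ hxN).left, ?_, Over.w _⟩
    rw [← cancel_mono iK.left, Category.assoc, ← Over.comp_left, hiQ]
    change (X₀.torsionLift _ hxN).left ≫ ((X₀.torsionIncl p (p ^ 2) hdvd ≫ e).left ≫ c 2) = (aO ≫ iK).left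
    rw [← Category.assoc, ← Over.comp_left, hz, hyO]
  -- §K THE SQUARE `X₀[p²] = Y[p²] ×_K X₀[p]` (top edge `[p] : X₀[p²] ↠ X₀[p]`), and FLATNESS of `δ`
  have hep : e ^ p = X₀.torsionMulMap p p (p ^ 2) hsq' ≫ X₀.torsionIncl p (p ^ 2) hdvd ≫ e := by
    apply (hi₀P 2).hom_ext
    · rw [MonObj.pow_comp, he, Category.assoc, Category.assoc, he, AbelianSchemeOver.torsionIncl_ι,
        AbelianSchemeOver.torsionMulMap_ι, AbelianSchemeOver.comp_mulN]
    · exact toUnit_unique _ _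
  have hcomm : j.left ≫ δ.left = (X₀.torsionMulMap p p (p ^ 2) hsq').left ≫ iQ.left := by
    rw [← cancel_mono iK.left, Category.assoc, Category.assoc, ← Over.comp_left _ _ _ δ iK, hδ,
      ← Over.comp_left _ _ _ iQ iK, hiQ, hred, hep, Over.comp_left, Category.assoc]
    rfl
  have hP : IsPullback j.left (X₀.torsionMulMap p p (p ^ 2) hsq').left δ.left iQ.left := by
    refine IsPullback.of_bot ?_ hcomm hQ
    rw [Over.w (X₀.torsionMulMap p p (p ^ 2) hsq'), Over.w δ]
    exact hcP
  haveI : Flat (X₀.torsionMulMap p p (p ^ 2) hsq').left := X₀.flat_torsionMulMap_left hp0 p (p ^ 2) hsq'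
  haveI : Surjective (X₀.torsionMulMap p p (p ^ 2) hsq').left := X₀.surjective_torsionMulMap_left hp0 p (p ^ 2) hsq'
  have hflatδ : Flat δ.left := by
    haveI : Flat (δ.left ≫ K.hom) := by rw [Over.w δ]; infer_instance
    exact Morphisms.flat_of_flat_of_isPullback_specMap_quotient_mk J ⟨2, by rw [pow_two]; exact hJJ⟩
      (IsNoetherian.noetherian J) hQ hP
  -- §L SURJECTIVITY: `Spec (A⧸J) → Spec A` is onto (the base has one point), hence so are `iQ` and `j ≫ δ = [p] ≫ iQ`
  haveI : Surjective (Spec.map (CommRingCat.ofHom (Ideal.Quotient.mk J))) := by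
    refine ⟨fun z => ?_⟩
    haveI : Nontrivial (A ⧸ J) := Ideal.Quotient.nontrivial_iff.mpr hJ
    obtain ⟨y⟩ := (inferInstance : Nonempty (PrimeSpectrum (A ⧸ J)))
    refine ⟨y, ?_⟩
    have h1 : ∀ w : PrimeSpectrum A, w = IsLocalRing.closedPoint A := fun w =>
      PrimeSpectrum.ext (IsLocalRing.eq_maximalIdeal (IsArtinianRing.isMaximal_of_isPrime w.asIdeal))
    exact (h1 _).trans (h1 z).symm
  haveI : Surjective iQ.left := MorphismProperty.of_isPullback (P := @Surjective) hQ.flip inferInstance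
  haveI : Surjective (j.left ≫ δ.left) := by rw [hcomm]; infer_instance
  exact ⟨δ, hflatδ, Surjective.of_comp j.left δ.left⟩

end SerreTateKernel

end Literature.AlgebraicGeometry.GroupSchemes

end
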